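import Literature.AnabelianGeometry.EtaleTheta.Discharge.Sec2Cor218iCoreClauses
import Literature.AnabelianGeometry.EtaleTheta.Discharge.Sec2DtpYThetaAbelianCorollaries
import Literature.AnabelianGeometry.EtaleTheta.Discharge.Sec2Cor219iSubquotientsInducedIff
import Literature.AnabelianGeometry.EtaleTheta.SettingModelChiGroupLevelHolds
import Literature.AnabelianGeometry.EtaleTheta.SettingModelChiOriginProfile
import Literature.AnabelianGeometry.EtaleTheta.SettingModelTateTheta
import Literature.AnabelianGeometry.EtaleTheta.SettingModelTateGroupLevel
import HarnessLib

/-!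
# [EtTh] Cor 2.18 (i) (`Π•_Y`-clause, label clause), Cor 2.18 (iii), Cor 2.19 (i) for the §1 → §2
# rigidity data AT THE RECORD MODEL `ThetaSetting.modelχ p` (proof-only; FROZEN FACT-LIST rows F-0620
# (two clauses), F-0622, F-0623, F-0626, F-0627; existence content of F-0628)

Mochizuki, *The étale theta function and its Frobenioid-theoretic manifestations*, Publ. RIMS **45**
(2009) [EtTh], §2: Cor. 2.18 (i) PRIMS PDF p. 60, Cor. 2.18 (iii) p. 61, Cor. 2.19 (i) p. 64
[cite: MochizukiEtTh2009, Cor 2.19 (i) p.64].  Cell `abc-iut`, block F, seat abc-iut-f-148 (gen 2;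
F-TRANCHES tranche 148 = F-0627/F-0628/F-0629/F-0630 of D-0078 (S1)).  PROOF-ONLY: no definition, no
instance, nothing of another seat edited or restated.  Companion of `Sec2Cor218iCoreClauses.lean` (the
`L`-free core of F-0620 that Cor. 2.19 (i) consumes; the label clause unsatisfiable at some labelling under
temp-slimness), COMPLEMENTARY to abc-iut-f-150's `Sec2Cor218Cor219AtModelChi.lean` and abc-iut-f-149's
`Sec2RigidityAtModelChi.lean` / `Sec2RigidityAtModelTate.lean` (which record Cor. 2.18 (iii) at the models
and Cor. 2.19 (i) modulo the FULL six-clause `Cor218_i`): here the two `L`-dependent / `L`-free clauses of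
F-0620 are decided at the models and Cor. 2.19 (i) is cut down to the three-clause core.

AT THE RECORD MODEL `ThetaSetting.modelχ p` (abc-iut-L2-t1's `SettingModelChiTheta.lean`:
`Π^tp_X = (F̂₂ ×_Ẑ ℤ) ⋊_χ G_{ℚ_p}`, non-trivial Galois action on `Δ_Θ`), for EVERY étale-theta datum `E`,
every `X̲̲`-choice `C : E.DoubleUnderline l`, every level `μ`, every `hC`/`hS`/`h15` and every labelling
`L` (the construction's DATA binders, kept as binders so the statements match any consumer's term):

* `isCompact_GtpY_modelχ` — `Π^tp_Y = Ker pr₂ ⋊ G_{ℚ_p}` is COMPACT (image of `Ker pr₂ × G_{ℚ_p}`;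
  abc-iut-L2-t11's `isCompact_ker_gfpSnd`, Krull-compactness of `G_{ℚ_p}`);
* `rigidData_map_PiY_eq_modelχ` — the `Π•_Y`-clause of F-0620 `Cor218_i` HOLDS for every topological
  automorphism of `Π^tp_X̲̲` (compactness); `not_forall_cuspLabels_cor218_i_modelχ` — its cusp-LABEL
  clause FAILS at some labelling (slimness), so F-0620's instance form is not a theorem uniformly in `L`;
* `rigidData_cor219_i_modelχ_of_core` / `_of_extends` — **F-0627 `Cor219_i_subquotients` and F-0626
  `Cor219_i_splittings` HOLD modulo the `L`-free three-clause core of F-0620 ONLY**, i.e. modulo ONE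
  property of the synthetic group: every topological automorphism of the open `Π^tp_X̲̲` extends to a
  `Δ^tp_X`-stabilising topological automorphism of `Π^tp_X` (the shape of "Prop. 2.4 [K-core]" +
  "[Mzk2] Lem. 1.3.8"; the NAMED RESIDUAL at the record model, not claimed); Prop. 2.14 (i) is supplied by
  abc-iut-L2-t8's `rigidData_prop214_i_of_origin` with `modelχ_isEtThOrigin`, `hYcl_modelχ`;
* `cor219_i_subquotients_iff_modelχ`, `exists_induces_modelχ` — gen 0's characterisation of F-0627
  (p434009) and the existence content of F-0628 "every bi-continuous `α` of `Π^tp_Y̲̲[μ_N]` induces `ᾱ`"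
  (p433161) are UNCONDITIONAL at the record model (their hypothesis F-0623 discharged there by
  temp-slimness, abc-iut-w5-d111/w5-d249's `isSlimGroup_piTemp_curveχ`).
§4 repeats all of this at the STAGE-2 record model `ThetaSetting.modelχq p i j hj` (abc-iut-L2-t5's
`SettingModelTateTheta.lean`, Tate-sheared `b`-axis; Tate instance `modelTate p = modelχq p 1 2`):
`isCompact_GtpY_modelχq`, `rigidData_map_PiY_eq_modelχq`, `not_forall_cuspLabels_cor218_i_modelχq`,
`rigidData_cor219_i_modelχq_of_core` / `_of_extends`, `exists_induces_modelχq`.  HONESTY DATUM (abc-iut-f-149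
gen 3): at stage 1 the construction binder `h15 : Prop15iii E hC` is REFUTED for the section-family data
(abc-iut-L2-t12's `not_prop15iii_etaleThetaDataχSec`), so the §3 forms are consistency evidence for
{`IsSlimGroup`, `IsEtThOrigin`, `hYcl`} but vacuous in `h15` for those data; stage 2 is where Prop. 1.5 (iii)
is to be witnessed (R78 cluster, not claimed here) — hence §4.

HONEST LABEL: `modelχ` is a SEMI-SYNTHETIC model of the typed §1 interface — consistency / non-vacuity
evidence for the lane-C2 binder set, not the tempered `π₁` of a curve; F-0620 stays a FACT-policy row;
nothing of [EtTh] (refereed) is asserted; no side is taken on [IUTchIII] Cor. 3.12; typed ≠ proved; a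
FACT row is an assumption label, not an endorsement.
-/

noncomputable section

namespace Literature.AnabelianGeometry.EtaleTheta


/-! ## §3. At the stage-1 record model `ThetaSetting.modelχ p` -/

namespace SettingModel

open Literature.AnabelianGeometry.SemiGraphs

variable (p : ℕ) [Fact p.Prime]

/-- **`Π^tp_Y` of the χ-model is COMPACT**: `Π^tp_Y = {g | pr₂ g.left = 0}` is the image of the compact
`Ker pr₂ × G_{ℚ_p}` (`Ker pr₂` closed in the profinite `F̂₂ × {0}`, abc-iut-L2-t11's
`isCompact_ker_gfpSnd`; `G_{ℚ_p}` Krull-compact) under `(k, σ) ↦ inl k · inr σ`.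
[cite: MochizukiEtTh2009, §1 p.12] -/
theorem isCompact_GtpY_modelχ :
    IsCompact (((ThetaSetting.modelχ p).GtpY : Subgroup (PiTpχ p)) : Set (PiTpχ p)) := by
  haveI := compactSpace_GQp p
  have hKc : CompactSpace ↥(MonoidHom.ker gfpSnd) := isCompact_iff_compactSpace.mp isCompact_ker_gfpSnd
  let f : ↥(MonoidHom.ker gfpSnd) × GQp p → PiTpχ p := fun kσ =>
    SemidirectProduct.inl (kσ.1 : Gfp) * SemidirectProduct.inr kσ.2
  have hf : Continuous f :=
    ((continuous_inlχ p).comp (continuous_subtype_val.comp continuous_fst)).mul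
      ((continuous_inrχ p).comp continuous_snd)
  have hrange : Set.range f = (((ThetaSetting.modelχ p).GtpY : Subgroup (PiTpχ p)) : Set (PiTpχ p)) := by
    ext g
    rw [Set.mem_range, SetLike.mem_coe, mem_GtpY_modelχ_iff]
    constructor
    · rintro ⟨⟨k, σ⟩, rfl⟩
      have hk : gfpSnd (k : Gfp) = 1 := k.2
      simpa only [f, SemidirectProduct.mul_left, SemidirectProduct.left_inl, SemidirectProduct.right_inl,
        SemidirectProduct.left_inr, map_one, MulAut.one_apply, mul_one] using hk
    · intro hg
      exact ⟨(⟨g.left, hg⟩, g.right), SemidirectProduct.inl_left_mul_inr_right g⟩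
  rw [← hrange]
  exact isCompact_range hf

variable {E : (ThetaSetting.modelχ p).EtaleThetaData} {l : ℕ} (C : E.DoubleUnderline l) {N : ℕ+}
  (μ : (ThetaSetting.modelχ p).CyclotomeMod l N)

/-- **The `Π•_Y`-clause of F-0620 `Cor218_i` HOLDS at the χ-model's rigidity data**, for every
topological automorphism `γ` of `Π^tp_X̲̲` (compactness of `Π^tp_Y`).
[cite: MochizukiEtTh2009, Cor 2.18 (i) p.60] -/
theorem rigidData_map_PiY_eq_modelχ (hC : (ThetaSetting.modelχ p).Compat)
    (hS : (ThetaSetting.modelχ p).Sec2Hyps) (h15 : ThetaSetting.Prop15iii E hC) (L : C.CuspLabels)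
    (γ : ↥C.Huu ≃ₜ* ↥C.Huu) :
    (C.rigidData μ hC hS h15 L).PiY.map γ.toMulEquiv.toMonoidHom = (C.rigidData μ hC hS h15 L).PiY :=
  C.rigidData_map_PiY_eq_of_isCompact_GtpY μ hC hS h15 L (isCompact_GtpY_modelχ p) γ

/-- **The label clause of F-0620 FAILS at some labelling at the χ-model**, unconditionally:
`¬ ∀ L, (C.rigidData μ hC hS h15 L).Cor218_i`. [cite: MochizukiEtTh2009, Cor 2.18 (i) p.60] -/
theorem not_forall_cuspLabels_cor218_i_modelχ (hC : (ThetaSetting.modelχ p).Compat)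
    (hS : (ThetaSetting.modelχ p).Sec2Hyps) (h15 : ThetaSetting.Prop15iii E hC) :
    ¬ ∀ L : C.CuspLabels,
      Literature.AnabelianGeometry.EtaleTheta.RigidData.Cor218_i (C.rigidData μ hC hS h15 L) :=
  C.not_forall_cuspLabels_cor218_i_of_slim μ hC hS h15 (isSlimGroup_piTemp_curveχ p)

/-- **F-0627 / F-0626 at the χ-model modulo the `L`-free core of F-0620 ONLY** (temp-slimness being the
theorem `isSlimGroup_piTemp_curveχ`, and Prop. 2.14 (i) being abc-iut-L2-t8's
`rigidData_prop214_i_of_origin` with `modelχ_isEtThOrigin`, `hYcl_modelχ`; compare abc-iut-f-150's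
`cor219_i_subquotients_modelχ` / `cor219_i_splittings_modelχ`, which bind the full six-clause `Cor218_i`).
[cite: MochizukiEtTh2009, Cor 2.19 (i) p.64] -/
theorem rigidData_cor219_i_modelχ_of_core (hC : (ThetaSetting.modelχ p).Compat)
    (hS : (ThetaSetting.modelχ p).Sec2Hyps) (h15 : ThetaSetting.Prop15iii E hC) (L : C.CuspLabels)
    (hcore : ∀ γ : ↥C.Huu ≃ₜ* ↥C.Huu,
      (C.rigidData μ hC hS h15 L).aug.ker.map γ.toMulEquiv.toMonoidHom =
          (C.rigidData μ hC hS h15 L).aug.ker ∧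
        (C.rigidData μ hC hS h15 L).thetaKer.map γ.toMulEquiv.toMonoidHom =
          (C.rigidData μ hC hS h15 L).thetaKer ∧
        (C.rigidData μ hC hS h15 L).lDeltaTheta.map γ.toMulEquiv.toMonoidHom =
          (C.rigidData μ hC hS h15 L).lDeltaTheta) :
    Literature.AnabelianGeometry.EtaleTheta.RigidData.Cor219_i_subquotients (C.rigidData μ hC hS h15 L) ∧
      Literature.AnabelianGeometry.EtaleTheta.RigidData.Cor219_i_splittings (C.rigidData μ hC hS h15 L) := by
  obtain ⟨h1, h2⟩ := (C.rigidData μ hC hS h15 L).cor219_i_of_core_tempSlim hcore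
    (C.tempSlim_Huu (isSlimGroup_piTemp_curveχ p))
  exact ⟨h1, h2 (C.rigidData_prop214_i_of_origin μ hC hS h15 L (ThetaSetting.modelχ_isEtThOrigin p)
    (hYcl_modelχ p))⟩

/-- **F-0627 / F-0626 at the χ-model modulo ONE property of the synthetic group**: every topological
automorphism of the open subgroup `Π^tp_X̲̲` extends to a `Δ^tp_X`-stabilising topological automorphism of
`Π^tp_X = (F̂₂ ×_Ẑ ℤ) ⋊_χ G_{ℚ_p}` (the shape of "Prop. 2.4 [K-core]" + "[Mzk2] Lem. 1.3.8" — the named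
residual; NOT claimed here). [cite: MochizukiEtTh2009, Cor 2.19 (i) p.64] -/
theorem rigidData_cor219_i_modelχ_of_extends (hC : (ThetaSetting.modelχ p).Compat)
    (hS : (ThetaSetting.modelχ p).Sec2Hyps) (h15 : ThetaSetting.Prop15iii E hC) (L : C.CuspLabels)
    (hext : ∀ γ : ↥C.Huu ≃ₜ* ↥C.Huu,
      ∃ Γ : (ThetaSetting.modelχ p).PiTemp ≃ₜ* (ThetaSetting.modelχ p).PiTemp,
        (∀ h : C.Huu, Γ (h : (ThetaSetting.modelχ p).PiTemp) =
          ((γ h : C.Huu) : (ThetaSetting.modelχ p).PiTemp)) ∧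
        (ThetaSetting.modelχ p).DeltaTemp.map Γ.toMulEquiv.toMonoidHom =
          (ThetaSetting.modelχ p).DeltaTemp) :
    Literature.AnabelianGeometry.EtaleTheta.RigidData.Cor219_i_subquotients (C.rigidData μ hC hS h15 L) ∧
      Literature.AnabelianGeometry.EtaleTheta.RigidData.Cor219_i_splittings (C.rigidData μ hC hS h15 L) :=
  rigidData_cor219_i_modelχ_of_core p C μ hC hS h15 L (C.rigidData_core_of_extends μ hC hS h15 L hext)

/-- **F-0627 CHARACTERISED at the χ-model, unconditionally** (gen 0's
`cor219_i_subquotients_iff_induced_invariance`, its hypothesis F-0623 discharged at the record model by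
temp-slimness): `Cor219_i_subquotients` holds for the χ-model's rigidity data IFF every automorphism of
every model environment `M(η)` induces an automorphism of `Π^tp_Y̲̲` preserving
`Ker(Π^tp_Y̲̲ → (Π^tp_Y)^Θ)`, `l·Δ_Θ` and `Δ^tp_Y̲̲`. [cite: MochizukiEtTh2009, Cor 2.19 (i) p.64] -/
theorem cor219_i_subquotients_iff_modelχ (hC : (ThetaSetting.modelχ p).Compat)
    (hS : (ThetaSetting.modelχ p).Sec2Hyps) (h15 : ThetaSetting.Prop15iii E hC) (L : C.CuspLabels) :
    Literature.AnabelianGeometry.EtaleTheta.RigidData.Cor219_i_subquotients (C.rigidData μ hC hS h15 L) ↔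
      ∀ (η : (C.rigidData μ hC hS h15 L).PiYdd → (C.rigidData μ hC hS h15 L).mu)
        (hη : η ∈ (C.rigidData μ hC hS h15 L).thetaCocycles)
        (α : ((C.rigidData μ hC hS h15 L).modelMono hη).Iso ((C.rigidData μ hC hS h15 L).modelMono hη)),
        ∃ a : (C.rigidData μ hC hS h15 L).PiY ≃ₜ* (C.rigidData μ hC hS h15 L).PiY,
          (C.rigidData μ hC hS h15 L).Induces α.e.toMulEquiv a ∧
          ((C.rigidData μ hC hS h15 L).thetaKer.comap (C.rigidData μ hC hS h15 L).PiY.subtype).map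
              a.toMulEquiv.toMonoidHom =
            (C.rigidData μ hC hS h15 L).thetaKer.comap (C.rigidData μ hC hS h15 L).PiY.subtype ∧
          ((C.rigidData μ hC hS h15 L).lDeltaTheta.comap (C.rigidData μ hC hS h15 L).PiY.subtype).map
              a.toMulEquiv.toMonoidHom =
            (C.rigidData μ hC hS h15 L).lDeltaTheta.comap (C.rigidData μ hC hS h15 L).PiY.subtype ∧
          (C.rigidData μ hC hS h15 L).augY.ker.map a.toMulEquiv.toMonoidHom =
            (C.rigidData μ hC hS h15 L).augY.ker :=
  (C.rigidData μ hC hS h15 L).cor219_i_subquotients_iff_induced_invariance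
    ((C.rigidData μ hC hS h15 L).cor218_iii_of_tempSlim (C.tempSlim_Huu (isSlimGroup_piTemp_curveχ p))).2

/-- **The existence content of F-0628 `Induces` at the χ-model, unconditionally**: every bi-continuous
automorphism `α` of `Π^tp_Y̲̲[μ_N]` induces an automorphism `ᾱ` of `Π^tp_Y̲̲` ([EtTh] Prop. 2.11 (ii) /
Prop. 2.14 (iii): "every `α` induces one") — gen 0's `exists_induces_of_cor218_iii_quotient` with F-0623
discharged at the record model. [cite: MochizukiEtTh2009, Prop 2.14 (iii) p.49] -/
theorem exists_induces_modelχ (hC : (ThetaSetting.modelχ p).Compat)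
    (hS : (ThetaSetting.modelχ p).Sec2Hyps) (h15 : ThetaSetting.Prop15iii E hC) (L : C.CuspLabels)
    (α : MulAut (C.rigidData μ hC hS h15 L).env) (hα : α ∈ contMulAut (C.rigidData μ hC hS h15 L).env) :
    ∃ a : (C.rigidData μ hC hS h15 L).PiY ≃ₜ* (C.rigidData μ hC hS h15 L).PiY,
      (C.rigidData μ hC hS h15 L).Induces α a :=
  (C.rigidData μ hC hS h15 L).exists_induces_of_cor218_iii_quotient
    ((C.rigidData μ hC hS h15 L).cor218_iii_of_tempSlim (C.tempSlim_Huu (isSlimGroup_piTemp_curveχ p))).2 α hα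

end SettingModel

/-! ## §4. At the stage-2 record model `ThetaSetting.modelχq p i j hj` (Tate-sheared `b`-axis) -/

namespace SettingModel

open Literature.AnabelianGeometry.SemiGraphs

variable (p : ℕ) [Fact p.Prime] (i j : ℤ) (hj : Even j)

/-- **`Π^tp_Y` of the stage-2 model is COMPACT** (`= inl(Ker pr₂) · inr(G_{ℚ_p})`, as at the χ-model).
[cite: MochizukiEtTh2009, §1 p.12] -/
theorem isCompact_GtpY_modelχq :
    IsCompact (((ThetaSetting.modelχq p i j hj).GtpY : Subgroup (PiTpχq p i j)) : Set (PiTpχq p i j)) := by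
  haveI := compactSpace_GQp p
  have hKc : CompactSpace ↥(MonoidHom.ker gfpSnd) := isCompact_iff_compactSpace.mp isCompact_ker_gfpSnd
  let f : ↥(MonoidHom.ker gfpSnd) × GQp p → PiTpχq p i j := fun kσ =>
    SemidirectProduct.inl (kσ.1 : Gfp) * SemidirectProduct.inr kσ.2
  have hf : Continuous f :=
    ((continuous_inlχq p i j).comp (continuous_subtype_val.comp continuous_fst)).mul
      ((continuous_inrχq p i j).comp continuous_snd)
  have hmem : ∀ g : PiTpχq p i j, g ∈ (ThetaSetting.modelχq p i j hj).GtpY ↔ gfpSnd g.left = 1 := fun g => by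
    change g ∈ ((tateTwistData₀ p i j).toZ).ker ↔ _
    rw [MonoidHom.mem_ker, GfpTwistData₀.toZ_apply]
  have hrange : Set.range f =
      (((ThetaSetting.modelχq p i j hj).GtpY : Subgroup (PiTpχq p i j)) : Set (PiTpχq p i j)) := by
    ext g
    rw [Set.mem_range, SetLike.mem_coe, hmem]
    constructor
    · rintro ⟨⟨k, σ⟩, rfl⟩
      have hk : gfpSnd (k : Gfp) = 1 := k.2
      simpa only [f, SemidirectProduct.mul_left, SemidirectProduct.left_inl, SemidirectProduct.right_inl,
        SemidirectProduct.left_inr, map_one, MulAut.one_apply, mul_one] using hk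
    · intro hg
      exact ⟨(⟨g.left, hg⟩, g.right), SemidirectProduct.inl_left_mul_inr_right g⟩
  rw [← hrange]
  exact isCompact_range hf

variable {E : (ThetaSetting.modelχq p i j hj).EtaleThetaData} {l : ℕ} (C : E.DoubleUnderline l) {N : ℕ+}
  (μ : (ThetaSetting.modelχq p i j hj).CyclotomeMod l N)

/-- **The `Π•_Y`-clause of F-0620 HOLDS at the stage-2 model's rigidity data**, for every topological
automorphism of `Π^tp_X̲̲`. [cite: MochizukiEtTh2009, Cor 2.18 (i) p.60] -/
theorem rigidData_map_PiY_eq_modelχq (hC : (ThetaSetting.modelχq p i j hj).Compat)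
    (hS : (ThetaSetting.modelχq p i j hj).Sec2Hyps) (h15 : ThetaSetting.Prop15iii E hC)
    (L : C.CuspLabels) (γ : ↥C.Huu ≃ₜ* ↥C.Huu) :
    (C.rigidData μ hC hS h15 L).PiY.map γ.toMulEquiv.toMonoidHom = (C.rigidData μ hC hS h15 L).PiY :=
  C.rigidData_map_PiY_eq_of_isCompact_GtpY μ hC hS h15 L (isCompact_GtpY_modelχq p i j hj) γ

/-- **The label clause of F-0620 FAILS at some labelling at the stage-2 model**, unconditionally.
[cite: MochizukiEtTh2009, Cor 2.18 (i) p.60] -/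
theorem not_forall_cuspLabels_cor218_i_modelχq (hC : (ThetaSetting.modelχq p i j hj).Compat)
    (hS : (ThetaSetting.modelχq p i j hj).Sec2Hyps) (h15 : ThetaSetting.Prop15iii E hC) :
    ¬ ∀ L : C.CuspLabels,
      Literature.AnabelianGeometry.EtaleTheta.RigidData.Cor218_i (C.rigidData μ hC hS h15 L) :=
  C.not_forall_cuspLabels_cor218_i_of_slim μ hC hS h15 (isSlimGroup_PiTpχq p i j)

/-- **F-0627 / F-0626 at the stage-2 model modulo the `L`-free core of F-0620 ONLY** (Prop. 2.14 (i) by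
`rigidData_prop214_i_of_origin` with `modelχq_isEtThOrigin`, `hYcl_modelχq`).
[cite: MochizukiEtTh2009, Cor 2.19 (i) p.64] -/
theorem rigidData_cor219_i_modelχq_of_core (hC : (ThetaSetting.modelχq p i j hj).Compat)
    (hS : (ThetaSetting.modelχq p i j hj).Sec2Hyps) (h15 : ThetaSetting.Prop15iii E hC)
    (L : C.CuspLabels)
    (hcore : ∀ γ : ↥C.Huu ≃ₜ* ↥C.Huu,
      (C.rigidData μ hC hS h15 L).aug.ker.map γ.toMulEquiv.toMonoidHom =
          (C.rigidData μ hC hS h15 L).aug.ker ∧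
        (C.rigidData μ hC hS h15 L).thetaKer.map γ.toMulEquiv.toMonoidHom =
          (C.rigidData μ hC hS h15 L).thetaKer ∧
        (C.rigidData μ hC hS h15 L).lDeltaTheta.map γ.toMulEquiv.toMonoidHom =
          (C.rigidData μ hC hS h15 L).lDeltaTheta) :
    Literature.AnabelianGeometry.EtaleTheta.RigidData.Cor219_i_subquotients (C.rigidData μ hC hS h15 L) ∧
      Literature.AnabelianGeometry.EtaleTheta.RigidData.Cor219_i_splittings (C.rigidData μ hC hS h15 L) := by
  obtain ⟨h1, h2⟩ := (C.rigidData μ hC hS h15 L).cor219_i_of_core_tempSlim hcore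
    (C.tempSlim_Huu (isSlimGroup_PiTpχq p i j))
  exact ⟨h1, h2 (C.rigidData_prop214_i_of_origin μ hC hS h15 L
    (ThetaSetting.modelχq_isEtThOrigin p i j hj) (hYcl_modelχq p i j hj))⟩

/-- **F-0627 / F-0626 at the stage-2 model modulo the extension-to-a-`Δ`-stabilising-automorphism property
of the synthetic group `(F̂₂ ×_Ẑ ℤ) ⋊ G_{ℚ_p}` (Tate-sheared action)** — the named residual, not claimed.
[cite: MochizukiEtTh2009, Cor 2.19 (i) p.64] -/
theorem rigidData_cor219_i_modelχq_of_extends (hC : (ThetaSetting.modelχq p i j hj).Compat)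
    (hS : (ThetaSetting.modelχq p i j hj).Sec2Hyps) (h15 : ThetaSetting.Prop15iii E hC)
    (L : C.CuspLabels)
    (hext : ∀ γ : ↥C.Huu ≃ₜ* ↥C.Huu,
      ∃ Γ : (ThetaSetting.modelχq p i j hj).PiTemp ≃ₜ* (ThetaSetting.modelχq p i j hj).PiTemp,
        (∀ h : C.Huu, Γ (h : (ThetaSetting.modelχq p i j hj).PiTemp) =
          ((γ h : C.Huu) : (ThetaSetting.modelχq p i j hj).PiTemp)) ∧
        (ThetaSetting.modelχq p i j hj).DeltaTemp.map Γ.toMulEquiv.toMonoidHom =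
          (ThetaSetting.modelχq p i j hj).DeltaTemp) :
    Literature.AnabelianGeometry.EtaleTheta.RigidData.Cor219_i_subquotients (C.rigidData μ hC hS h15 L) ∧
      Literature.AnabelianGeometry.EtaleTheta.RigidData.Cor219_i_splittings (C.rigidData μ hC hS h15 L) :=
  rigidData_cor219_i_modelχq_of_core p i j hj C μ hC hS h15 L (C.rigidData_core_of_extends μ hC hS h15 L hext)

/-- **The existence content of F-0628 `Induces` at the stage-2 model, unconditionally.**
[cite: MochizukiEtTh2009, Prop 2.14 (iii) p.49] -/
theorem exists_induces_modelχq (hC : (ThetaSetting.modelχq p i j hj).Compat)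
    (hS : (ThetaSetting.modelχq p i j hj).Sec2Hyps) (h15 : ThetaSetting.Prop15iii E hC)
    (L : C.CuspLabels) (α : MulAut (C.rigidData μ hC hS h15 L).env)
    (hα : α ∈ contMulAut (C.rigidData μ hC hS h15 L).env) :
    ∃ a : (C.rigidData μ hC hS h15 L).PiY ≃ₜ* (C.rigidData μ hC hS h15 L).PiY,
      (C.rigidData μ hC hS h15 L).Induces α a :=
  (C.rigidData μ hC hS h15 L).exists_induces_of_cor218_iii_quotient
    ((C.rigidData μ hC hS h15 L).cor218_iii_of_tempSlim (C.tempSlim_Huu (isSlimGroup_PiTpχq p i j))).2 α hα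

end SettingModel

end Literature.AnabelianGeometry.EtaleTheta

end
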